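import Summits.ResolutionOfSingularities.ResolutionOfSingularities.Theorems.PurelyInseparableDim4ResConePrimeShadeTail
import Summits.ResolutionOfSingularities.ResolutionOfSingularities.Theorems.PurelyInseparableDim4ResConeActiveThreshold
import Summits.ResolutionOfSingularities.ResolutionOfSingularities.Theorems.PurelyInseparableDim4ResConeHeavyPermanentSet
import HarnessLib
import HarnessLib.Audit.Tags

/-!
# Purely inseparable four-folds — NO EVENTUALLY-GOOD TAIL, EVERY PRIME `p`, EVERY SHADE `d < p`: the PURE two-letter game is empty, so
# every binary-cone trap carries a frozen letter (K2(p) lane, SLICE C; the holder's one-tracked-frame assembly of `…PrimeShadeTail` /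
# `…SubTwoShadeTail` run at threshold `p − d` on the ledger of `…ActiveThreshold`; file-holder res-dim4-p-5 g5)

[OURS · counted 0 · cell `res-dim4-pi` · K2(p) lane, slice C (general-`p` programme) · seat p-5 g5, on the holder's (res-dim4-p-12 g5) assembly
pattern — E/K/L step lemmas of res-dim4-p-9 / p-7 / p-2, tracker `no_tail_of_tracked_frame` of p-12.]  Nothing here proves K2(p) for any
`p`, `NoIsolatedTrap p p` or resolution of singularities in dimension ≥ 4 / characteristic `p` — NOT proved; a theorem about OUR frame's
witnessed `Step0 p` chains.  AI kernel work, weaker than expert review.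

THE ARGUMENT.  Suppose the tail is GOOD from `M` (≤ 2 boundary letters, pairwise TT).  By `exists_active_ge_threshold` (with `P = ∅`,
`ℓ = p − d`) some letter weighs `≥ p − d` at every `m ≥ M`; the one at `M` cannot stay untouched for ever (`no_tail_of_permanent_heavy_letter`),
so some step `k₁ ≥ M` charts or translates a letter `W` of weight `≥ p − d`.  E (`heavy_entryFrame`, `n := p − r W ≤ d`) frames `W` at `k₁`,
L (`tail_heavy_lose_step`) carries the frame onto the newborn — which weighs `≥ p − d` by `threshold_le_newborn_of_touch` (NO FALL-OFF) — with
`0 < αs`; from there the tracker `no_tail_of_tracked_frame` runs for ever with run datum «`p − d ≤ r_k i` ∧ frame ∧ `0 < αs`» and `Φ := βs`: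
a KEEP step of the tracked letter is K (`tail_heavy_keep_step`, `n := p − r_k h ∈ [1, d]`, `βs` drops), a hit/chart of it is L onto a
newborn of weight `≥ p − d` again (no fall-off), `βs` not increasing.  Contradiction.
* **`no_eventuallyGood_tail (p) (hdp : d < p)`** — no witnessed isolated above-floor `Step0 p` chain with `x^{r₀} ∣ F₀`, constant shade
  `d < p` and `e_G ≡ 2` from `k₀` is GOOD from some `M ≥ k₀` on.  At `d = p − 1` this re-derives `no_primeShade_binaryCone_tail` (there every
  tail is eventually GOOD, `eventually_good_prime`); the new content is every `d ≤ p − 2`: branch (G) of `good_or_permanent` is EMPTY, i.e.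
  every binary-cone trap has a PERMANENT boundary letter, and the frozen set of `good_modulo_frozen` is non-empty.
[cite: CossartJannsenSaito2020, Thm. 3.10(4), Thm. 3.14, Thm. 9.3, Lemma 13.2] [cite: Hauser2010, §F] [cite: HauserPerlega2019PRIMS, §2]
bears_on: LADDER-RESOLUTION:D157-DOOR2 (res-dim4-pi · K2(p) = `RidgeBudget.NoAboveFloorTrap p p` · TAIL(p, d, 2) ⊆ «frozen letter present»).
Supports stmt-ResolutionOfSingularities-16155 (helper).
-/

set_option linter.dupNamespace false -- mandated namespace of this single-conjunct summit

noncomputable section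

namespace Summit.ResolutionOfSingularities.ResolutionOfSingularities.Theorems.PIDim4

namespace ResCone

open MvPolynomial Finset
open Literature.AlgebraicGeometry.Resolution
open Literature.AlgebraicGeometry.Resolution.CentreBlowup
open Literature.AlgebraicGeometry.Resolution.Hauser2010
open Literature.AlgebraicGeometry.Resolution.HauserPerlega2019
open Literature.AlgebraicGeometry.Resolution.WeightedOrder
open PointBlowup (direction)

variable {K : Type} [Field K] [DecidableEq K] (p : ℕ) [hp : Fact p.Prime] [CharP K p]

/-- **NO EVENTUALLY-GOOD TAIL** (every prime `p`, every shade `d < p`): no witnessed isolated above-floor `Step0 p` chain with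
`x^{r₀} ∣ F₀`, constant shade `d` and binary residual cone (`e_G ≡ 2`) from `k₀` has, from some `M ≥ k₀` on, at most two boundary
letters, pairwise TT, at every time — the PURE two-letter game is empty.  (One tracked frame at threshold `p − d`; the ledger supplies
the threshold letter, the first hit, and NO FALL-OFF.) [OURS]
[cite: CossartJannsenSaito2020, Thm. 3.10(4), Thm. 3.14, Thm. 9.3, Lemma 13.2] [cite: Hauser2010, §F] -/
theorem no_eventuallyGood_tail {c : ℕ → State K} {j : ℕ → Fin 4} {b : ℕ → Fin 4 → K}
    (hc : ∀ k, IsIsolated p (c k).F ∧ Step0 p (c k) (c (k + 1))) (hw : FreeTail.IsWitnessedChain p c j b)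
    (hr0 : ∀ e ∈ (c 0).F.support, (c 0).r ≤ e) (hfloor : ∀ k, ordZero (c k).F ≠ p) {k₀ d : ℕ} (hdp : d < p)
    (hshade : ∀ k, k₀ ≤ k → (c k).shade = (d : ℕ∞)) (he : ∀ k, k₀ ≤ k → Module.finrank K (resVertex (c k)) = 2)
    {M : ℕ} (hM : k₀ ≤ M) (hG : ∀ m, M ≤ m → ((∃ x y : Fin 4, ∀ i, i ≠ x → i ≠ y → (c m).r i = 0) ∧
        (∀ x y : Fin 4, x ≠ y → 1 ≤ (c m).r x → 1 ≤ (c m).r y →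
          ∀ v ∈ resVertex (c m), v x = 0 → v y = 0 → v = 0))) : False := by
  classical
  obtain ⟨-, hlaw, hbj, hband, hpair⟩ := tail_weights_laws hc hw hr0 hfloor hshade
  -- every weight is `≤ p − 2` (isolation pair law with any other letter)
  have hle : ∀ k (i : Fin 4), (c k).r i ≤ p - 2 := by
    intro k i
    obtain ⟨i', hi'⟩ := exists_ne i
    have := hpair k i i' (Ne.symm hi')
    omega
  -- a kept letter keeps its weight
  have hkept : ∀ k, k₀ ≤ k → ∀ (h : Fin 4), j k ≠ h → b k h = 0 → (c (k + 1)).r h = (c k).r h := by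
    intro k hk h hjh hbh
    rw [hlaw k hk, Finsupp.coe_update, Function.update_of_ne (Ne.symm hjh),
      Finsupp.filter_apply_pos (fun i => b k i = 0) ((c k).r) hbh]
  -- the GOOD data in the frozen-set form of `…ActiveThreshold`, with `P = ∅` and `ℓ = p − d`
  have hperm : ∀ z ∈ (∅ : Finset (Fin 4)), ∀ m, M ≤ m → 1 ≤ (c m).r z ∧ z ≠ j m ∧ b m z = 0 :=
    fun z hz => absurd hz (Finset.notMem_empty z)
  have hgood : ∀ m, M ≤ m →
      ((∃ x y : Fin 4, ∀ i, i ∉ (∅ : Finset (Fin 4)) → i ≠ x → i ≠ y → (c m).r i = 0) ∧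
        (∀ x y : Fin 4, x ∉ (∅ : Finset (Fin 4)) → y ∉ (∅ : Finset (Fin 4)) → x ≠ y → 1 ≤ (c m).r x →
          1 ≤ (c m).r y → ∀ v ∈ resVertex (c m), v x = 0 → v y = 0 → v = 0)) := by
    intro m hm
    obtain ⟨⟨x, y, hxy⟩, hTT⟩ := hG m hm
    exact ⟨⟨x, y, fun i _ => hxy i⟩, fun x y _ _ => hTT x y⟩
  have hℓ : d + ∑ z ∈ (∅ : Finset (Fin 4)), (c M).r z + (p - d) = p := by
    rw [Finset.sum_empty]; omega
  have hthr : ∀ m, M ≤ m → ∃ i, p - d ≤ (c m).r i := fun m hm => by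
    obtain ⟨i, -, hi⟩ := exists_active_ge_threshold p hc hw hr0 hfloor hshade hM hperm hgood hℓ hm
    exact ⟨i, hi⟩
  have hnofall : ∀ k, M ≤ k → ∀ (h : Fin 4), p - d ≤ (c k).r h → (j k = h ∨ b k h ≠ 0) →
      p - d ≤ (c (k + 1)).r (j k) := fun k hk h hh htouch =>
    threshold_le_newborn_of_touch p hc hw hr0 hfloor hshade hM hperm hgood hℓ hk (Finset.notMem_empty h) hh htouch
  -- START: some step `k₁ ≥ M` charts or translates a letter of weight `≥ p − d`
  have hstart : ∃ k, M ≤ k ∧ ∃ W : Fin 4, p - d ≤ (c k).r W ∧ (j k = W ∨ b k W ≠ 0) := by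
    by_contra hno
    push Not at hno
    obtain ⟨W, hW⟩ := hthr M le_rfl
    -- `W` is then permanent with frozen weight `≥ p − d`
    have hfrozen : ∀ m, M ≤ m → (c m).r W = (c M).r W ∧ (j m ≠ W ∧ b m W = 0) := by
      intro m hm
      induction m, hm using Nat.le_induction with
      | base => exact ⟨rfl, hno M le_rfl W hW⟩
      | succ m hm ih =>
        obtain ⟨hrm, hjm, hbm⟩ := ih
        have hrm1 : (c (m + 1)).r W = (c M).r W := by rw [hkept m (by omega) W hjm hbm, hrm]
        exact ⟨hrm1, hno (m + 1) (by omega) W (by rw [hrm1]; exact hW)⟩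
    exact no_tail_of_permanent_heavy_letter p hc hw hr0 hfloor hshade hM (h := W) (fun m hm => (hfrozen m hm).2)
      (by omega)
  obtain ⟨k₁, hk₁, W, hWt, hhit⟩ := hstart
  have hk₁0 : k₀ ≤ k₁ := by omega
  obtain ⟨hpo₁, ho2₁⟩ := hband k₁ hk₁0
  have hnb₁ := hnofall k₁ hk₁ W hWt hhit
  obtain ⟨hnew₁, hnewpos₁, hnewlt₁, -⟩ := tail_newborn_weight hc hw hr0 hfloor hshade hk₁0
  -- E at `k₁` on `W` (`n := p − r W ≤ d`), then L across step `k₁` (`n := p − newborn weight ≤ d`: no fall-off)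
  obtain ⟨L₀, M₀, hM₀, hL₀u1, hy₀, hne₀, hδ₀, -⟩ := heavy_entryFrame (p := p) (d := d) (n := p - (c k₁).r W) hdp
    (by omega) hc hw hr0 hfloor hshade he hk₁0 (W := W) (by omega)
    (heavyLine_direction_ne_zero (hbj k₁) hhit)
  obtain ⟨L₁, M₁, ⟨hM₁, hL₁u1, hy₁, hne₁, hδ₁, -⟩, hpos₁, -⟩ := tail_heavy_lose_step (p := p) (d := d)
    (n := p - ((c k₁).r.degree + d - p)) hdp (by rw [hnew₁] at hnb₁; omega) hc hw hr0 hfloor hshade he hk₁0 (by omega)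
    (heavyLine_direction_ne_zero (hbj k₁) hhit) hM₀ hL₀u1 hy₀ hne₀ hδ₀
  -- RUN: the tracker with threshold `p − d`
  refine no_tail_of_tracked_frame p hc hw (k₁ := k₁ + 1)
    (Fr := (Fin (2 + 2) → Fin 4 → K) × (Fin 4 → Fin (2 + 2) → K))
    (fun k i f => p - d ≤ (c k).r i ∧
      (∀ t u, ∑ s, f.2 t s * f.1 s u = if t = u then 1 else 0) ∧ f.1 (u1 2) = Pi.single i 1 ∧
      (∀ s, s ≠ u1 2 → s ≠ u2 2 → ∀ w ∈ resVertex (c k), ∑ t, f.1 s t * w t = 0) ∧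
      (pts (fun s => algebraMap (MvPolynomial (Fin 4) K) (OriginLocalization K 4) (∑ t, C (f.1 s t) * X t))
        (Ideal.span {algebraMap (MvPolynomial (Fin 4) K) (OriginLocalization K 4)
            ((c k).F.divMonomial (c k).r)}) d).Nonempty ∧
      Nat.factorial d < deltaS (fun s => algebraMap (MvPolynomial (Fin 4) K) (OriginLocalization K 4) (∑ t, C (f.1 s t) * X t))
        (Ideal.span {algebraMap (MvPolynomial (Fin 4) K) (OriginLocalization K 4)
            ((c k).F.divMonomial (c k).r)}) d ∧
      0 < alphaS (fun s => algebraMap (MvPolynomial (Fin 4) K) (OriginLocalization K 4) (∑ t, C (f.1 s t) * X t))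
        (Ideal.span {algebraMap (MvPolynomial (Fin 4) K) (OriginLocalization K 4)
            ((c k).F.divMonomial (c k).r)}) d)
    (fun k f => betaS (fun s => algebraMap (MvPolynomial (Fin 4) K) (OriginLocalization K 4) (∑ t, C (f.1 s t) * X t))
        (Ideal.span {algebraMap (MvPolynomial (Fin 4) K) (OriginLocalization K 4)
            ((c k).F.divMonomial (c k).r)}) d)
    ?_ ?_ (h₀ := j k₁) (f₀ := ⟨L₁, M₁⟩) ⟨hnb₁, hM₁, hL₁u1, hy₁, hne₁, hδ₁, hpos₁⟩
  · -- (L): the frame follows the hit onto the newborn, which weighs `≥ p − d` (no fall-off)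
    rintro k hk h ⟨L, M⟩ ⟨hwt, hM, hLu1, hy, hne, hδ, -⟩ hhit'
    have hk0 : k₀ ≤ k := by omega
    obtain ⟨hpo, ho2⟩ := hband k hk0
    have hnb := hnofall k (by omega) h hwt hhit'
    obtain ⟨hnew, hnewpos, hnewlt, -⟩ := tail_newborn_weight hc hw hr0 hfloor hshade hk0
    obtain ⟨L', M', ⟨hM', hL'u1, hy', hne', hδ', -⟩, hpos', hle'⟩ := tail_heavy_lose_step (p := p) (d := d)
      (n := p - ((c k).r.degree + d - p)) hdp (by rw [hnew] at hnb; omega) hc hw hr0 hfloor hshade he hk0 (by omega)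
      (heavyLine_direction_ne_zero (hbj k) hhit') hM hLu1 hy hne hδ
    exact ⟨⟨L', M'⟩, ⟨hnb, hM', hL'u1, hy', hne', hδ', hpos'⟩, hle'⟩
  · -- (K): the frame stays on the kept letter, `βs` drops (`n := p − r_k h ∈ [1, d]`)
    rintro k hk h ⟨L, M⟩ ⟨hwt, hM, hLu1, hy, hne, hδ, hα0⟩ hjh hbh
    have hk0 : k₀ ≤ k := by omega
    have hrle := hle k h
    obtain ⟨L', M', ⟨hM', hL'u1, hy', hne', hδ', -⟩, hpos', hlt'⟩ := tail_heavy_keep_step (p := p) (d := d)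
      (n := p - (c k).r h) hdp (by omega) (by omega) hc hw hr0 hfloor hshade he hk0 (h := h) (by omega) hjh hbh
      hM hLu1 hy hne hδ hα0
    exact ⟨⟨L', M'⟩, ⟨by rw [hkept k hk0 h hjh hbh]; exact hwt, hM', hL'u1, hy', hne', hδ', hpos'⟩, hlt'⟩

end ResCone

end Summit.ResolutionOfSingularities.ResolutionOfSingularities.Theorems.PIDim4

end
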